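import Summits.Langlands.Langlands.Theorems.SqrtFiveQuarticCoversCertB3H8Coords
import Summits.Langlands.Langlands.Theorems.SqrtFiveQuarticCoversCertH12B7WeakNF
import Summits.Langlands.Langlands.Theorems.SqrtFiveQuarticCoversCertS3H8Coords
import Summits.Langlands.Langlands.Theorems.SqrtFiveQuarticCoversCertB3E7ZDS
import Summits.Langlands.Langlands.Theorems.SqrtFiveQuarticCoversCertS3H12WeakNF
import Summits.Langlands.Langlands.Theorems.SqrtFiveQuarticCoversSheets
import Summits.Langlands.Langlands.Theorems.SqrtFiveQuarticCoversCertB3E7MordellWeilE7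

/-!
# Route `SqrtFiveQuarticCovers` — RECORD v5: the crux `RefinedLocusModular` from the WEAKEST LANDED
# named input of every certificate child, census inputs ELIMINATED (lg-quartmod typ-1 g0, TABLE
# seat 8; helper of the crux item stmt-Langlands-17833)

Successor of `SqrtFiveQuarticCoversRecord.lean` (v1: typ-3, p671588; ref-2 countersign 22:03:20Z;
14 named inputs).  Same shape — ONE kernel-checked statement whose binders are written-out named
inputs, proof = one application of the ledger glue `refinedLocusModularGlue_of_facts` (asm-plan,
`…Sheets.lean`) — but each child is now fed through the sibling module that asks the LEAST of its
named inputs, the gap PROVED in the kernel tonight (lead g2's «(α) pattern»), and sheet 4.5's two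
census inputs are GONE (eng-7 g4 σ-form census, PROVED), row 1 is split into MODEL + COORDINATE LIST (in-e6c), and sheet 4.5's Mordell–Weil input is a THEOREM (stub `MordellWeilE7` CLOSED BY NAME: eng-7 g5 p682119 `MordellWeilE7 := mordellWeilE7_of_ratPoints W_ratPoints W5Descent.ratPoints` over eng-8 g3's complete 2-isogeny + Fermat descent for 49a4/ℚ (p679088/p679435/p679899 `W_ratPoints`) and eng-7 g5's descent for the 5-twist (p679455/p680127/p680497/p680761 `W5Descent.ratPoints`), glued through `mordellWeilE7_of_fixedPoints` (GroupLaw p674866) by eng-8 g3's `…CertB3E7MordellWeilQ`): 12 named inputs (14 in v1, 12 in v3, 13 in v4).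

| child (sheets) | theorem used (module, p-id) | binders here | moved into the kernel since v1 |
|---|---|---|---|
| `CertB3H8` (4.2/4.6) | `certB3H8_of_modelIdentification_of_coords` (CertB3H8Coords + CertB3H8CoordsKernel, in-e6c; Literature anchor `FLSModularCurveBorelThreeSplitFiveJMap` p675611) ∘ `certB3H8_of_facts` (p670548 + anchors p670819) | `hK1c` MODEL (b3,H8-framings ⇒ point of FLS's printed quartic `b3s5Quartic` with the twisted lift quadrics and `c₄³·JDen = JNum·Δ`), `hE6c` COORDINATE LIST (every such point over a totally real quartic `K ∋ r`: one of the nine printed `k`-points or the orbit-B pair over `t⁴ − 35t² + 205`), `hB` CertE11B | the composite `hE6` (CFC∘MODEL at `j`-level) is SPLIT: «point on the list ⇒ `c₄ = 0 ∨ m_B = 0`» is a kernel theorem (`c4_eq_zero_or_mB_of_b3s5_listedPoint`; cusps excluded, `j = 0` fibre, orbit-B `j(t)` root of `m_B`) |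
| `CertH12B7` (4.1/4.3) | `certH12B7_of_modelIdentificationWeak_of_theoremZ` (CertH12B7WeakNF, p673376, eng-4 g3) | `hK1w`, `hZ` TheoremZ | NF-K1-Z's side conditions `u ≠ 0`, `t² + t − 1 ≠ 0` |
| `CertS3H8` (4.4/4.8) | `certS3H8_of_facts_coords` (CertS3H8Coords, p672826, typ-1) | `hM` PRINT (Literature fact), `hE9c` CertE9coords | «`w, v ∈ k` ⇒ `j ∈ k`» through the printed (js3s5) |
| `CertB3E7` (4.5) | `certB3E7_of_modelIdentificationInf_of_mordellWeil` (CertB3E7ZDS, p675221, eng-7 g4) applied to the CLOSED stub `MordellWeilE7` (eng-7 g5 p682119 over eng-8 g3 `W_ratPoints` p679899 + eng-7 g5 `W5Descent.ratPoints` p680761 + `…CertB3E7MordellWeilQ`; W(k)-step: GroupLaw p674866 typ-1 ∥ MordellWeil/Bridge p674579/p675676 eng-8 g2) | `hK1inf` NF-K1-E10∞ ONLY | the `x₂ = ∞` exclusion (p672401); the whole ZDS census (p675221 chain); «the group law read on `x`»; and now the Mordell–Weil datum itself (`49a4(ℚ(√5)) = ℤ/2` as a kernel theorem) |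
| `CertS3H12` (4.7) | `certS3H12_of_modelIdentificationWeak_of_caseTwoEmpty_smooth` (CertS3H12WeakNF, p673359, eng-4 g3) | `hNFw`, `hDat'` CaseTwoEmptyS3H12-smooth | NF-K1's side conditions; the singular locus (p668984) |

KINDS (NAMED-INPUT-TABLE v1.5; ref-2 read c05b4ca8c3af004c; ref-1 g2 sanity 163b229ffb3509a6):
PRINT — `hM` (FLS 2015 §2.2 + §5.3), `hFLS` (FLS 2015 Thm. 1), `hBC` (Thorne 2016 L7.1); MODEL
IDENTIFICATIONS (moduli interpretation; no modular curves in Mathlib) — `hK1c` (F/G: ref-1 PARI ∥ eng-3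
Sage, byte-identical, Sturm-proved; twist: E6-PREP ∥ eng-5), `hK1w`, `hK1inf`, `hNFw`; CERTIFIED FINITE COMPUTATIONS, each on ≥ 2 independent exact
lineages with certnum releases as recorded in CENSUS §15 — `hE6c`, `hB` (4.2/4.6: lineages R1 ref-1 +
E6′ eng-1/ref-1, RELEASES l.135–l.139, E13 eng-6 g3 third in flight; E11(B) eng-8/eng-9 + kernel count), `hZ` (THEOREM Z: eng-2 + eng-3/eng-8,
RQ-029), `hE9c` (E9-COARSE eng-9 + E9 eng-3; l.131–l.134), `hDat'` (E8 CASE 2: eng-4 + eng-5 + E12 ×2; RQ-028).  Every binder text is BYTE-IDENTICAL to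
the binder of the theorem it feeds (generator `HOME/lg-quartmod-typ-1/recordweak/gen_record_weak.py
--v5`, manifest with binder shas).

HONEST STATUS: CONDITIONAL (`proof.conditional` on `RefinedLocusModular` and on `Target`); closes
nothing; a FRONTIER RECORD for ONE explicit family (totally real quartic `K ∋ √5`, `E/K` on the
refined `(3,5,7)`-locus); «a certified finite datum is not a modularity statement»; nothing here
proves modularity of elliptic curves over quartic fields in general.
-/


set_option linter.dupNamespace false -- project-wide option (lakefile weak.linter.dupNamespace); `Summit.Langlands.Langlands` is the mandated namespace

namespace Summit.Langlands.Langlands.Theorems.SqrtFiveQuarticCovers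

open scoped Matrix
open Literature.NumberTheory.Automorphic Literature.NumberTheory.Automorphic.FLS2015
open Summit.Langlands.Langlands.Theses.SqrtFiveQuarticCovers

set_option maxRecDepth 8192 in -- statement elaboration only (as in `SqrtFiveQuarticCoversRecord.lean`)
set_option maxHeartbeats 1000000 in -- statement elaboration only: ten written-out hypothesis types
/-- **RECORD v5 — the crux `RefinedLocusModular` from the WEAKEST LANDED named input of every
certificate child, written out.**  Binders (each BYTE-IDENTICAL to the binder of the child theorem it
feeds; see the module docstring for kinds/lineages): `hK1c`, `hE6c`, `hB` (⇒ `CertB3H8`); `hK1w`, `hZ`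
(⇒ `CertH12B7`); `hM`, `hE9c` (⇒ `CertS3H8`); `hK1inf` (⇒ `CertB3E7`);
`hNFw`, `hDat'` (⇒ `CertS3H12`); `hFLS`, `hBC` (printed bridge) — sheet 4.5's census inputs `hZmm`/`hZmi` are no longer binders (eng-7 g4, p675221).  Proof: the ledger glue
`refinedLocusModularGlue_of_facts` (asm-plan) on the five child theorems — one term.  CONDITIONAL
(`proof.conditional`), closes nothing; «a certified finite datum is not a modularity statement».
[cite: FreitasLeHungSiksek2015, Thm. 1, §2.2, §§5.2–5.4] [cite: Thorne2016, Lemma 7.1] [cite: Zywina2015, §1.2–1.3] -/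
theorem refinedLocusModular_of_namedInputs_weak5
    -- ── CertB3H8: sheets 4.2 + 4.6 — `certB3H8_of_modelIdentification_of_coords` (module SqrtFiveQuarticCoversCertB3H8Coords) ──
    (hK1c : ∀ (K : Type) [Field K] [NumberField K], ∀ r : K, r ^ 2 = 5 →
      ∀ E : WeierstrassCurve (NumberField.RingOfIntegers K), E.Δ ≠ 0 →
        (∃ ρ : Literature.NumberTheory.GaloisRepresentations.FramedGaloisRep K (ZMod 3) 2, (∃ e : (E.baseChange K).geomTorsion ((3 : ℕ) : ℤ) ≃+ (Fin 2 → ZMod 3), ∀ (σ : Field.absoluteGaloisGroup K) (P : (E.baseChange K).geomTorsion ((3 : ℕ) : ℤ)), e (σ • P) = ((ρ σ : GL (Fin 2) (ZMod 3)) : Matrix (Fin 2) (Fin 2) (ZMod 3)) *ᵥ (e P)) ∧ ((∀ σ : Field.absoluteGaloisGroup K, (((ρ σ : GL (Fin 2) (ZMod 3)) : Matrix (Fin 2) (Fin 2) (ZMod 3)) 1 0 = 0)))) →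
        (∃ ρ : Literature.NumberTheory.GaloisRepresentations.FramedGaloisRep K (ZMod 5) 2, (∃ e : (E.baseChange K).geomTorsion ((5 : ℕ) : ℤ) ≃+ (Fin 2 → ZMod 5), ∀ (σ : Field.absoluteGaloisGroup K) (P : (E.baseChange K).geomTorsion ((5 : ℕ) : ℤ)), e (σ • P) = ((ρ σ : GL (Fin 2) (ZMod 5)) : Matrix (Fin 2) (Fin 2) (ZMod 5)) *ᵥ (e P)) ∧ ((∀ σ : Field.absoluteGaloisGroup K, (ρ σ : GL (Fin 2) (ZMod 5)) ∈ Subgroup.closure ({(⟨!![2, 0; 0, 3], !![3, 0; 0, 2], by decide, by decide⟩ : GL (Fin 2) (ZMod 5)), (⟨!![0, 1; 1, 0], !![0, 1; 1, 0], by decide, by decide⟩ : GL (Fin 2) (ZMod 5))} : Set (GL (Fin 2) (ZMod 5)))))) →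
          ∃ x y z u v : K, (x ≠ 0 ∨ y ≠ 0 ∨ z ≠ 0) ∧ b3s5Quartic x y z = 0 ∧
            6 * u ^ 2 = (5 + r) * (-3 * x ^ 2 + 6 * x * y - 14 * x * z + 17 * y ^ 2 + 14 * y * z - 3 * z ^ 2) ∧
            6 * (u * v) = (5 + r) * (3 * x ^ 2 + 3 * x * y - 4 * x * z - 8 * y ^ 2 + 13 * y * z + 3 * z ^ 2) ∧
            6 * v ^ 2 = (5 + r) * (-3 * x ^ 2 - 12 * x * y - 14 * x * z + 8 * y ^ 2 - 4 * y * z - 3 * z ^ 2) ∧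
            (E.baseChange K).c₄ ^ 3 * b3s5JDen x y z = b3s5JNum x y z * (E.baseChange K).Δ)
    (hE6c : ∀ (K : Type) [Field K] [NumberField K], NumberField.IsTotallyReal K →
      Module.finrank ℚ K = 4 → ∀ r : K, r ^ 2 = 5 → ∀ x y z u v : K,
        (x ≠ 0 ∨ y ≠ 0 ∨ z ≠ 0) → b3s5Quartic x y z = 0 →
        6 * u ^ 2 = (5 + r) * (-3 * x ^ 2 + 6 * x * y - 14 * x * z + 17 * y ^ 2 + 14 * y * z - 3 * z ^ 2) →
        6 * (u * v) = (5 + r) * (3 * x ^ 2 + 3 * x * y - 4 * x * z - 8 * y ^ 2 + 13 * y * z + 3 * z ^ 2) →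
        6 * v ^ 2 = (5 + r) * (-3 * x ^ 2 - 12 * x * y - 14 * x * z + 8 * y ^ 2 - 4 * y * z - 3 * z ^ 2) →
      (x = 0 ∧ y = 0) ∨ (y = 0 ∧ z = 0) ∨ (y = -x ∧ z = 2 * x) ∨
      (x = -2 * z ∧ 2 * y = (-1 + r) * z) ∨ (x = -2 * z ∧ 2 * y = (-1 - r) * z) ∨
      (2 * x = (1 - r) * z ∧ y = (-3 + r) * z) ∨ (2 * x = (1 + r) * z ∧ y = (-3 - r) * z) ∨
      (2 * x = (1 + r) * z ∧ y = (2 + r) * z) ∨ (2 * x = (1 - r) * z ∧ y = (2 - r) * z) ∨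
      (∃ t : K, t ^ 4 - 35 * t ^ 2 + 205 = 0 ∧
        18 * x = (t ^ 2 + 9 * t - 13) * y ∧ 18 * z = (t ^ 2 - 9 * t - 31) * y))
    (hB : ∀ (K : Type) [Field K] [NumberField K], Module.finrank ℚ K = 4 →
      ∀ E : WeierstrassCurve (NumberField.RingOfIntegers K), E.Δ ≠ 0 →
        (E.baseChange K).c₄ ^ 12 - 736750 * (E.baseChange K).c₄ ^ 9 * (E.baseChange K).Δ
            - 107158989000 * (E.baseChange K).c₄ ^ 6 * (E.baseChange K).Δ ^ 2
            + 829200340371875 * (E.baseChange K).c₄ ^ 3 * (E.baseChange K).Δ ^ 3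
            - 601530697732559375 * (E.baseChange K).Δ ^ 4 = 0 →
        ∀ ρ : Literature.NumberTheory.GaloisRepresentations.FramedGaloisRep K (ZMod 7) 2,
          (∃ e : (E.baseChange K).geomTorsion ((7 : ℕ) : ℤ) ≃+ (Fin 2 → ZMod 7), ∀ (σ : Field.absoluteGaloisGroup K) (P : (E.baseChange K).geomTorsion ((7 : ℕ) : ℤ)), e (σ • P) = ((ρ σ : GL (Fin 2) (ZMod 7)) : Matrix (Fin 2) (Fin 2) (ZMod 7)) *ᵥ (e P)) →
          ∃ σ : Field.absoluteGaloisGroup K,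
            (Matrix.det ((ρ σ : GL (Fin 2) (ZMod 7)) : Matrix (Fin 2) (Fin 2) (ZMod 7)) = 3 ∨
              Matrix.det ((ρ σ : GL (Fin 2) (ZMod 7)) : Matrix (Fin 2) (Fin 2) (ZMod 7)) = 5 ∨
              Matrix.det ((ρ σ : GL (Fin 2) (ZMod 7)) : Matrix (Fin 2) (Fin 2) (ZMod 7)) = 6) ∧
            Matrix.trace ((ρ σ : GL (Fin 2) (ZMod 7)) : Matrix (Fin 2) (Fin 2) (ZMod 7)) ≠ 0 ∧
            ¬ IsSquare (Matrix.trace ((ρ σ : GL (Fin 2) (ZMod 7)) : Matrix (Fin 2) (Fin 2) (ZMod 7)) ^ 2 -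
              4 * Matrix.det ((ρ σ : GL (Fin 2) (ZMod 7)) : Matrix (Fin 2) (Fin 2) (ZMod 7))))
    -- ── CertH12B7: sheets 4.1 + 4.3 — `certH12B7_of_modelIdentificationWeak_of_theoremZ` (p673376): hK1w (NF-K1-Z without side conditions), hZ = TheoremZ ──
    (hK1w : ∀ (K : Type) [Field K] [NumberField K], (∃ r : K, r ^ 2 = 5) →
        ∀ E : WeierstrassCurve (NumberField.RingOfIntegers K), E.Δ ≠ 0 →
          (∃ ρ : Literature.NumberTheory.GaloisRepresentations.FramedGaloisRep K (ZMod 5) 2, (∃ e : (E.baseChange K).geomTorsion ((5 : ℕ) : ℤ) ≃+ (Fin 2 → ZMod 5), ∀ (σ : Field.absoluteGaloisGroup K) (P : (E.baseChange K).geomTorsion ((5 : ℕ) : ℤ)), e (σ • P) = ((ρ σ : GL (Fin 2) (ZMod 5)) : Matrix (Fin 2) (Fin 2) (ZMod 5)) *ᵥ (e P)) ∧ ((∀ σ : Field.absoluteGaloisGroup K, (ρ σ : GL (Fin 2) (ZMod 5)) ∈ Subgroup.closure ({(⟨!![3, 1; 3, 3], !![3, 4; 2, 3], by decide, by decide⟩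 : GL (Fin 2) (ZMod 5)), (⟨!![1, 0; 0, 4], !![1, 0; 0, 4], by decide, by decide⟩ : GL (Fin 2) (ZMod 5))} : Set (GL (Fin 2) (ZMod 5)))))) →
          (∃ ρ : Literature.NumberTheory.GaloisRepresentations.FramedGaloisRep K (ZMod 7) 2, (∃ e : (E.baseChange K).geomTorsion ((7 : ℕ) : ℤ) ≃+ (Fin 2 → ZMod 7), ∀ (σ : Field.absoluteGaloisGroup K) (P : (E.baseChange K).geomTorsion ((7 : ℕ) : ℤ)), e (σ • P) = ((ρ σ : GL (Fin 2) (ZMod 7)) : Matrix (Fin 2) (Fin 2) (ZMod 7)) *ᵥ (e P)) ∧ ((∀ σ : Field.absoluteGaloisGroup K, (((ρ σ : GL (Fin 2) (ZMod 7)) : Matrix (Fin 2) (Fin 2) (ZMod 7)) 1 0 = 0)))) →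
          ((E.baseChange K).c₄ ^ 3 = 0 * (E.baseChange K).Δ ∨
           (E.baseChange K).c₄ ^ 3 = 1728 * (E.baseChange K).Δ ∨
           (E.baseChange K).c₄ ^ 3 = 8000 * (E.baseChange K).Δ ∨
           ∃ r : K, r ^ 2 = 5 ∧ ∃ t u w : K,
            (E.baseChange K).c₄ ^ 3 * (t ^ 2 + t - 1) ^ 5 =
              125 * (t + 1) * (2 * t + 1) ^ 3 * (2 * t ^ 2 - 3 * t + 3) ^ 3 * (E.baseChange K).Δ ∧
            (E.baseChange K).c₄ ^ 3 * u = (u ^ 2 + 13 * u + 49) * (u ^ 2 + 5 * u + 1) ^ 3 * (E.baseChange K).Δ ∧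
            w ^ 2 = (5 + 2 * r) * (8 * t ^ 2 - 12 * t + 7)))
    (hZ : ∀ (K : Type) [Field K] [NumberField K], Module.finrank ℚ K = 4 →
        ∀ r : K, r ^ 2 = 5 → ∀ t u w : K, t ^ 2 + t - 1 ≠ 0 → u ≠ 0 →
          125 * (t + 1) * (2 * t + 1) ^ 3 * (2 * t ^ 2 - 3 * t + 3) ^ 3 * u =
            (u ^ 2 + 13 * u + 49) * (u ^ 2 + 5 * u + 1) ^ 3 * (t ^ 2 + t - 1) ^ 5 →
          w ^ 2 = (5 + 2 * r) * (8 * t ^ 2 - 12 * t + 7) →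
          (u ^ 2 + 13 * u + 49) * (u ^ 2 + 5 * u + 1) ≠ 0 →
          (u ^ 2 + 13 * u + 49) * (u ^ 2 + 5 * u + 1) ^ 3 ≠ 1728 * u →
          (u = -7 ∨ u = 7 ∨ 2 * u ^ 2 + (35 + 5 * r) * u + 98 = 0 ∨ 2 * u ^ 2 + (35 - 5 * r) * u + 98 = 0))
    -- ── CertS3H8: sheets 4.4 + 4.8 — `certS3H8_of_facts_coords` (p672826): hM (PRINT, Literature), hE9c = CertE9coords ──
    (hM : FLS2015.s3s5_jRelation_of_isTorsionGaloisRep)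
    (hE9c : ∀ (K : Type) [Field K] [NumberField K], NumberField.IsTotallyReal K →
      Module.finrank ℚ K = 4 → ∀ r : K, r ^ 2 = 5 → ∀ x₁ x₂ x₃ x₄ : K,
        s3s5Quadric x₁ x₂ x₃ x₄ = 0 → s3s5Cubic x₁ x₂ x₃ x₄ = 0 →
          x₄ ≠ 0 → x₃ ^ 2 - x₃ * x₄ - x₄ ^ 2 ≠ 0 →
            (∃ a b : ℚ, x₃ = ((a : K) + (b : K) * r) * x₄) ∧
            (∃ a b : ℚ, x₂ * x₃ = ((a : K) + (b : K) * r) * x₄ ^ 2))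
    -- ── CertB3E7: sheet 4.5 — `certB3E7_of_modelIdentificationInf_of_mordellWeil` (CertB3E7ZDS p675221) with the stub MordellWeilE7 CLOSED BY NAME (`MordellWeilE7`, p682119, module SqrtFiveQuarticCoversCertB3E7MordellWeilE7): hK1inf (NF-K1-E10∞) ONLY ──
    (hK1inf : ∀ (K : Type) [Field K] [NumberField K], Module.finrank ℚ K = 4 → (∃ r : K, r ^ 2 = 5) →
        ∀ E : WeierstrassCurve (NumberField.RingOfIntegers K), E.Δ ≠ 0 →
          (∃ ρ : Literature.NumberTheory.GaloisRepresentations.FramedGaloisRep K (ZMod 3) 2, (∃ e : (E.baseChange K).geomTorsion ((3 : ℕ) : ℤ) ≃+ (Fin 2 → ZMod 3), ∀ (σ : Field.absoluteGaloisGroup K) (P : (E.baseChange K).geomTorsion ((3 : ℕ) : ℤ)), e (σ • P) = ((ρ σ : GL (Fin 2) (ZMod 3)) : Matrix (Fin 2) (Fin 2) (ZMod 3)) *ᵥ (e P)) ∧ ((∀ σ : Field.absoluteGaloisGroup K, (((ρ σ : GL (Fin 2) (ZMod 3)) : Matrix (Fin 2) (Fin 2) (ZMod 3)) 1 0 = 0))))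 →
          (∃ ρ : Literature.NumberTheory.GaloisRepresentations.FramedGaloisRep K (ZMod 7) 2, (∃ e : (E.baseChange K).geomTorsion ((7 : ℕ) : ℤ) ≃+ (Fin 2 → ZMod 7), ∀ (σ : Field.absoluteGaloisGroup K) (P : (E.baseChange K).geomTorsion ((7 : ℕ) : ℤ)), e (σ • P) = ((ρ σ : GL (Fin 2) (ZMod 7)) : Matrix (Fin 2) (Fin 2) (ZMod 7)) *ᵥ (e P)) ∧ ((∀ σ : Field.absoluteGaloisGroup K, (ρ σ : GL (Fin 2) (ZMod 7)) ∈ Subgroup.closure ({(⟨!![0, 5; 3, 0], !![0, 5; 3, 0], by decide, by decide⟩ : GL (Fin 2) (ZMod 7)), (⟨!![5, 0; 3, 2], !![3, 0; 6, 4], by decide, by decide⟩ : GL (Fin 2) (ZMod 7))} : Set (GL (Fin 2) (ZMod 7)))))) →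
          ((E.baseChange K).c₄ ^ 3 = 1728 * (E.baseChange K).Δ ∨
           (∃ x₁ y₁ x₂ y₂ : K, y₁ ^ 2 = 7 * (16 * x₁ ^ 4 + 68 * x₁ ^ 3 + 111 * x₁ ^ 2 + 62 * x₁ + 11) ∧ y₂ ^ 2 = 7 * (16 * x₂ ^ 4 + 68 * x₂ ^ 3 + 111 * x₂ ^ 2 + 62 * x₂ + 11) ∧
            ((x₁ ^ 3 + x₁ ^ 2 - 2 * x₁ - 1) ^ 7) ≠ 0 ∧
            (E.baseChange K).c₄ ^ 3 * ((x₁ ^ 3 + x₁ ^ 2 - 2 * x₁ - 1) ^ 7) = ((3 * x₁ + 1) ^ 3 * (4 * x₁ ^ 2 + 5 * x₁ + 2) ^ 3 * (x₁ ^ 2 + 3 * x₁ + 4) ^ 3 * (x₁ ^ 2 + 10 * x₁ + 4) ^ 3) * (E.baseChange K).Δ ∧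
            ((3 * x₂ ^ 2 + 6 * x₂ + 2) ^ 2 * x₁ ^ 4 + (36 * x₂ ^ 4 + 125 * x₂ ^ 3 + 138 * x₂ ^ 2 + 60 * x₂ + 9) * x₁ ^ 3 + (48 * x₂ ^ 4 + 138 * x₂ ^ 3 + 111 * x₂ ^ 2 + 33 * x₂ + 3) * x₁ ^ 2 + (24 * x₂ ^ 4 + 60 * x₂ ^ 3 + 33 * x₂ ^ 2 + 5 * x₂) * x₁ + (4 * x₂ ^ 4 + 9 * x₂ ^ 3 + 3 * x₂ ^ 2)) = 0) ∨
           (∃ x₁ y₁ z : K, y₁ ^ 2 = 7 * (16 * x₁ ^ 4 + 68 * x₁ ^ 3 + 111 * x₁ ^ 2 + 62 * x₁ + 11) ∧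
            ((x₁ ^ 3 + x₁ ^ 2 - 2 * x₁ - 1) ^ 7) ≠ 0 ∧
            (E.baseChange K).c₄ ^ 3 * ((x₁ ^ 3 + x₁ ^ 2 - 2 * x₁ - 1) ^ 7) = ((3 * x₁ + 1) ^ 3 * (4 * x₁ ^ 2 + 5 * x₁ + 2) ^ 3 * (x₁ ^ 2 + 3 * x₁ + 4) ^ 3 * (x₁ ^ 2 + 10 * x₁ + 4) ^ 3) * (E.baseChange K).Δ ∧
            (3 * x₁ ^ 2 + 6 * x₁ + 2) ^ 2 = 0 ∧ z ^ 2 = 7)))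
    -- ── CertS3H12: sheet 4.7 — `certS3H12_of_modelIdentificationWeak_of_caseTwoEmpty_smooth` (p673359): hNFw (NF-K1 without side conditions), hDat′ = CaseTwoEmptyS3H12-smooth ──
    (hNFw : ∀ (K : Type) [Field K] [NumberField K], NumberField.IsTotallyReal K → Module.finrank ℚ K = 4 → (∃ r : K, r ^ 2 = 5) →
        ∀ E : WeierstrassCurve (NumberField.RingOfIntegers K), E.Δ ≠ 0 →
          (∃ ρ : Literature.NumberTheory.GaloisRepresentations.FramedGaloisRep K (ZMod 3) 2, (∃ e : (E.baseChange K).geomTorsion ((3 : ℕ) : ℤ) ≃+ (Fin 2 → ZMod 3), ∀ (σ : Field.absoluteGaloisGroup K) (P : (E.baseChange K).geomTorsion ((3 : ℕ) : ℤ)), e (σ • P) = ((ρ σ : GL (Fin 2) (ZMod 3)) : Matrix (Fin 2) (Fin 2) (ZMod 3)) *ᵥ (e P)) ∧ ((∀ σ : Field.absoluteGaloisGroup K, (ρ σ : GL (Fin 2) (ZMod 3)) ∈ Subgroup.closure ({(⟨!![1, 0; 0, 2], !![1, 0; 0, 2], by decide, by decide⟩ : GL (Fin 2) (ZMod 3)),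 (⟨!![0, 1; 1, 0], !![0, 1; 1, 0], by decide, by decide⟩ : GL (Fin 2) (ZMod 3))} : Set (GL (Fin 2) (ZMod 3)))))) →
          (∃ ρ : Literature.NumberTheory.GaloisRepresentations.FramedGaloisRep K (ZMod 5) 2, (∃ e : (E.baseChange K).geomTorsion ((5 : ℕ) : ℤ) ≃+ (Fin 2 → ZMod 5), ∀ (σ : Field.absoluteGaloisGroup K) (P : (E.baseChange K).geomTorsion ((5 : ℕ) : ℤ)), e (σ • P) = ((ρ σ : GL (Fin 2) (ZMod 5)) : Matrix (Fin 2) (Fin 2) (ZMod 5)) *ᵥ (e P)) ∧ ((∀ σ : Field.absoluteGaloisGroup K, (ρ σ : GL (Fin 2) (ZMod 5)) ∈ Subgroup.closure ({(⟨!![3, 1; 3, 3], !![3, 4; 2, 3], by decide, by decide⟩ : GL (Fin 2) (ZMod 5)), (⟨!![1, 0; 0, 4], !![1, 0; 0, 4], by decide, by decide⟩ : GL (Fin 2) (ZMod 5))} : Set (GL (Fin 2) (ZMod 5)))))) →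
          ∀ r : K, r ^ 2 = 5 →
            (E.baseChange K).c₄ = 0 ∨
            (E.baseChange K).c₄ ^ 3 = 8000 * (E.baseChange K).Δ ∨
            ∃ u t w : K,
              (E.baseChange K).c₄ ^ 3 * u ^ 3 = 27 * (u + 1) ^ 3 * (u - 3) ^ 3 * (E.baseChange K).Δ ∧
              (E.baseChange K).c₄ ^ 3 * (t ^ 2 + t - 1) ^ 5 =
                125 * (t + 1) * (2 * t + 1) ^ 3 * (2 * t ^ 2 - 3 * t + 3) ^ 3 * (E.baseChange K).Δ ∧
              (5 + 2 * r) * w ^ 2 = 8 * t ^ 2 - 12 * t + 7)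
    (hDat' : ∀ (K : Type) [Field K] [NumberField K], NumberField.IsTotallyReal K → Module.finrank ℚ K = 4 →
        ∀ r : K, r ^ 2 = 5 →
          ∀ t n v w : K,
            n ^ 3 = t ^ 3 + 2 * t ^ 2 - 1 →
            v ^ 2 = (5 * (2 * t + 1) * (2 * t ^ 2 - 3 * t + 3) * n) ^ 2
                + 12 * (5 * (2 * t + 1) * (2 * t ^ 2 - 3 * t + 3) * n) * (t ^ 2 + t - 1) ^ 2
                + 144 * (t ^ 2 + t - 1) ^ 4 →
            (5 + 2 * r) * w ^ 2 = 8 * t ^ 2 - 12 * t + 7 →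
            v ≠ 0 → w ≠ 0 →
            (∃ a b : ℚ, t = (a : K) + (b : K) * r) ∧ (∃ a b : ℚ, n = (a : K) + (b : K) * r))
    -- ── the printed bridge «j(E) ∈ ℚ(√5) ⇒ E modular» ──
    (hFLS : FLS2015_theorem1)
    (hBC : isModularEllipticCurve_baseChange_of_isSolvable_of_isAutomorphicOfWeightZero) :
    RefinedLocusModular :=
  refinedLocusModularGlue_of_facts hFLS hBC
    (certB3H8_of_modelIdentification_of_coords hK1c hE6c hB) (certH12B7_of_modelIdentificationWeak_of_theoremZ hK1w hZ)
    (certS3H8_of_facts_coords hM hE9c)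
    (certB3E7_of_modelIdentificationInf_of_mordellWeil hK1inf MordellWeilE7)
    (certS3H12_of_modelIdentificationWeak_of_caseTwoEmpty_smooth hNFw hDat')

set_option maxRecDepth 8192 in -- statement elaboration only (as in `SqrtFiveQuarticCoversRecord.lean`)
set_option maxHeartbeats 1000000 in -- statement elaboration only
/-- **RECORD v5, route level — `Target` from the weakest landed named inputs**: the ten certificate
inputs of `refinedLocusModular_of_namedInputs_weak5` (same names, same texts) and the seven printed
theorems as named facts (`FLS2015_theorem1`, Thorne L7.1, `Box2022_theorem1_1`,
`Box2022_theorem1_5_modular`, `FLS2015_theorem3`, `FLS2015_theorem4`, `Kalyanswamy2018_theorem1_2`;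
+ the printed `hM`).  Proof: `target_of_sheets_of_facts` (asm-plan) on the five child theorems.
CONDITIONAL; the residual `SectorComplement` is not touched; nothing here proves modularity of any
curve. [cite: Box2022, Thms. 1.1, 1.5, 7.1] [cite: FreitasLeHungSiksek2015, Thms. 1, 3, 4] [cite: Kalyanswamy2018, Thm. 1.2] -/
theorem target_of_namedInputs_weak5
    -- ── CertB3H8: sheets 4.2 + 4.6 — `certB3H8_of_modelIdentification_of_coords` (module SqrtFiveQuarticCoversCertB3H8Coords) ──
    (hK1c : ∀ (K : Type) [Field K] [NumberField K], ∀ r : K, r ^ 2 = 5 →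
      ∀ E : WeierstrassCurve (NumberField.RingOfIntegers K), E.Δ ≠ 0 →
        (∃ ρ : Literature.NumberTheory.GaloisRepresentations.FramedGaloisRep K (ZMod 3) 2, (∃ e : (E.baseChange K).geomTorsion ((3 : ℕ) : ℤ) ≃+ (Fin 2 → ZMod 3), ∀ (σ : Field.absoluteGaloisGroup K) (P : (E.baseChange K).geomTorsion ((3 : ℕ) : ℤ)), e (σ • P) = ((ρ σ : GL (Fin 2) (ZMod 3)) : Matrix (Fin 2) (Fin 2) (ZMod 3)) *ᵥ (e P)) ∧ ((∀ σ : Field.absoluteGaloisGroup K, (((ρ σ : GL (Fin 2) (ZMod 3)) : Matrix (Fin 2) (Fin 2) (ZMod 3)) 1 0 = 0)))) →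
        (∃ ρ : Literature.NumberTheory.GaloisRepresentations.FramedGaloisRep K (ZMod 5) 2, (∃ e : (E.baseChange K).geomTorsion ((5 : ℕ) : ℤ) ≃+ (Fin 2 → ZMod 5), ∀ (σ : Field.absoluteGaloisGroup K) (P : (E.baseChange K).geomTorsion ((5 : ℕ) : ℤ)), e (σ • P) = ((ρ σ : GL (Fin 2) (ZMod 5)) : Matrix (Fin 2) (Fin 2) (ZMod 5)) *ᵥ (e P)) ∧ ((∀ σ : Field.absoluteGaloisGroup K, (ρ σ : GL (Fin 2) (ZMod 5)) ∈ Subgroup.closure ({(⟨!![2, 0; 0, 3], !![3, 0; 0, 2], by decide, by decide⟩ : GL (Fin 2) (ZMod 5)), (⟨!![0, 1; 1, 0], !![0, 1; 1, 0], by decide, by decide⟩ : GL (Fin 2) (ZMod 5))} : Set (GL (Fin 2) (ZMod 5)))))) →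
          ∃ x y z u v : K, (x ≠ 0 ∨ y ≠ 0 ∨ z ≠ 0) ∧ b3s5Quartic x y z = 0 ∧
            6 * u ^ 2 = (5 + r) * (-3 * x ^ 2 + 6 * x * y - 14 * x * z + 17 * y ^ 2 + 14 * y * z - 3 * z ^ 2) ∧
            6 * (u * v) = (5 + r) * (3 * x ^ 2 + 3 * x * y - 4 * x * z - 8 * y ^ 2 + 13 * y * z + 3 * z ^ 2) ∧
            6 * v ^ 2 = (5 + r) * (-3 * x ^ 2 - 12 * x * y - 14 * x * z + 8 * y ^ 2 - 4 * y * z - 3 * z ^ 2) ∧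
            (E.baseChange K).c₄ ^ 3 * b3s5JDen x y z = b3s5JNum x y z * (E.baseChange K).Δ)
    (hE6c : ∀ (K : Type) [Field K] [NumberField K], NumberField.IsTotallyReal K →
      Module.finrank ℚ K = 4 → ∀ r : K, r ^ 2 = 5 → ∀ x y z u v : K,
        (x ≠ 0 ∨ y ≠ 0 ∨ z ≠ 0) → b3s5Quartic x y z = 0 →
        6 * u ^ 2 = (5 + r) * (-3 * x ^ 2 + 6 * x * y - 14 * x * z + 17 * y ^ 2 + 14 * y * z - 3 * z ^ 2) →
        6 * (u * v) = (5 + r) * (3 * x ^ 2 + 3 * x * y - 4 * x * z - 8 * y ^ 2 + 13 * y * z + 3 * z ^ 2) →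
        6 * v ^ 2 = (5 + r) * (-3 * x ^ 2 - 12 * x * y - 14 * x * z + 8 * y ^ 2 - 4 * y * z - 3 * z ^ 2) →
      (x = 0 ∧ y = 0) ∨ (y = 0 ∧ z = 0) ∨ (y = -x ∧ z = 2 * x) ∨
      (x = -2 * z ∧ 2 * y = (-1 + r) * z) ∨ (x = -2 * z ∧ 2 * y = (-1 - r) * z) ∨
      (2 * x = (1 - r) * z ∧ y = (-3 + r) * z) ∨ (2 * x = (1 + r) * z ∧ y = (-3 - r) * z) ∨
      (2 * x = (1 + r) * z ∧ y = (2 + r) * z) ∨ (2 * x = (1 - r) * z ∧ y = (2 - r) * z) ∨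
      (∃ t : K, t ^ 4 - 35 * t ^ 2 + 205 = 0 ∧
        18 * x = (t ^ 2 + 9 * t - 13) * y ∧ 18 * z = (t ^ 2 - 9 * t - 31) * y))
    (hB : ∀ (K : Type) [Field K] [NumberField K], Module.finrank ℚ K = 4 →
      ∀ E : WeierstrassCurve (NumberField.RingOfIntegers K), E.Δ ≠ 0 →
        (E.baseChange K).c₄ ^ 12 - 736750 * (E.baseChange K).c₄ ^ 9 * (E.baseChange K).Δ
            - 107158989000 * (E.baseChange K).c₄ ^ 6 * (E.baseChange K).Δ ^ 2
            + 829200340371875 * (E.baseChange K).c₄ ^ 3 * (E.baseChange K).Δ ^ 3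
            - 601530697732559375 * (E.baseChange K).Δ ^ 4 = 0 →
        ∀ ρ : Literature.NumberTheory.GaloisRepresentations.FramedGaloisRep K (ZMod 7) 2,
          (∃ e : (E.baseChange K).geomTorsion ((7 : ℕ) : ℤ) ≃+ (Fin 2 → ZMod 7), ∀ (σ : Field.absoluteGaloisGroup K) (P : (E.baseChange K).geomTorsion ((7 : ℕ) : ℤ)), e (σ • P) = ((ρ σ : GL (Fin 2) (ZMod 7)) : Matrix (Fin 2) (Fin 2) (ZMod 7)) *ᵥ (e P)) →
          ∃ σ : Field.absoluteGaloisGroup K,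
            (Matrix.det ((ρ σ : GL (Fin 2) (ZMod 7)) : Matrix (Fin 2) (Fin 2) (ZMod 7)) = 3 ∨
              Matrix.det ((ρ σ : GL (Fin 2) (ZMod 7)) : Matrix (Fin 2) (Fin 2) (ZMod 7)) = 5 ∨
              Matrix.det ((ρ σ : GL (Fin 2) (ZMod 7)) : Matrix (Fin 2) (Fin 2) (ZMod 7)) = 6) ∧
            Matrix.trace ((ρ σ : GL (Fin 2) (ZMod 7)) : Matrix (Fin 2) (Fin 2) (ZMod 7)) ≠ 0 ∧
            ¬ IsSquare (Matrix.trace ((ρ σ : GL (Fin 2) (ZMod 7)) : Matrix (Fin 2) (Fin 2) (ZMod 7)) ^ 2 -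
              4 * Matrix.det ((ρ σ : GL (Fin 2) (ZMod 7)) : Matrix (Fin 2) (Fin 2) (ZMod 7))))
    -- ── CertH12B7: sheets 4.1 + 4.3 — `certH12B7_of_modelIdentificationWeak_of_theoremZ` (p673376): hK1w (NF-K1-Z without side conditions), hZ = TheoremZ ──
    (hK1w : ∀ (K : Type) [Field K] [NumberField K], (∃ r : K, r ^ 2 = 5) →
        ∀ E : WeierstrassCurve (NumberField.RingOfIntegers K), E.Δ ≠ 0 →
          (∃ ρ : Literature.NumberTheory.GaloisRepresentations.FramedGaloisRep K (ZMod 5) 2, (∃ e : (E.baseChange K).geomTorsion ((5 : ℕ) : ℤ) ≃+ (Fin 2 → ZMod 5), ∀ (σ : Field.absoluteGaloisGroup K) (P : (E.baseChange K).geomTorsion ((5 : ℕ) : ℤ)), e (σ • P) = ((ρ σ : GL (Fin 2) (ZMod 5)) : Matrix (Fin 2) (Fin 2) (ZMod 5)) *ᵥ (e P)) ∧ ((∀ σ : Field.absoluteGaloisGroup K, (ρ σ : GL (Fin 2) (ZMod 5)) ∈ Subgroup.closure ({(⟨!![3, 1; 3, 3], !![3, 4; 2, 3], by decide, by decide⟩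 : GL (Fin 2) (ZMod 5)), (⟨!![1, 0; 0, 4], !![1, 0; 0, 4], by decide, by decide⟩ : GL (Fin 2) (ZMod 5))} : Set (GL (Fin 2) (ZMod 5)))))) →
          (∃ ρ : Literature.NumberTheory.GaloisRepresentations.FramedGaloisRep K (ZMod 7) 2, (∃ e : (E.baseChange K).geomTorsion ((7 : ℕ) : ℤ) ≃+ (Fin 2 → ZMod 7), ∀ (σ : Field.absoluteGaloisGroup K) (P : (E.baseChange K).geomTorsion ((7 : ℕ) : ℤ)), e (σ • P) = ((ρ σ : GL (Fin 2) (ZMod 7)) : Matrix (Fin 2) (Fin 2) (ZMod 7)) *ᵥ (e P)) ∧ ((∀ σ : Field.absoluteGaloisGroup K, (((ρ σ : GL (Fin 2) (ZMod 7)) : Matrix (Fin 2) (Fin 2) (ZMod 7)) 1 0 = 0)))) →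
          ((E.baseChange K).c₄ ^ 3 = 0 * (E.baseChange K).Δ ∨
           (E.baseChange K).c₄ ^ 3 = 1728 * (E.baseChange K).Δ ∨
           (E.baseChange K).c₄ ^ 3 = 8000 * (E.baseChange K).Δ ∨
           ∃ r : K, r ^ 2 = 5 ∧ ∃ t u w : K,
            (E.baseChange K).c₄ ^ 3 * (t ^ 2 + t - 1) ^ 5 =
              125 * (t + 1) * (2 * t + 1) ^ 3 * (2 * t ^ 2 - 3 * t + 3) ^ 3 * (E.baseChange K).Δ ∧
            (E.baseChange K).c₄ ^ 3 * u = (u ^ 2 + 13 * u + 49) * (u ^ 2 + 5 * u + 1) ^ 3 * (E.baseChange K).Δ ∧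
            w ^ 2 = (5 + 2 * r) * (8 * t ^ 2 - 12 * t + 7)))
    (hZ : ∀ (K : Type) [Field K] [NumberField K], Module.finrank ℚ K = 4 →
        ∀ r : K, r ^ 2 = 5 → ∀ t u w : K, t ^ 2 + t - 1 ≠ 0 → u ≠ 0 →
          125 * (t + 1) * (2 * t + 1) ^ 3 * (2 * t ^ 2 - 3 * t + 3) ^ 3 * u =
            (u ^ 2 + 13 * u + 49) * (u ^ 2 + 5 * u + 1) ^ 3 * (t ^ 2 + t - 1) ^ 5 →
          w ^ 2 = (5 + 2 * r) * (8 * t ^ 2 - 12 * t + 7) →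
          (u ^ 2 + 13 * u + 49) * (u ^ 2 + 5 * u + 1) ≠ 0 →
          (u ^ 2 + 13 * u + 49) * (u ^ 2 + 5 * u + 1) ^ 3 ≠ 1728 * u →
          (u = -7 ∨ u = 7 ∨ 2 * u ^ 2 + (35 + 5 * r) * u + 98 = 0 ∨ 2 * u ^ 2 + (35 - 5 * r) * u + 98 = 0))
    -- ── CertS3H8: sheets 4.4 + 4.8 — `certS3H8_of_facts_coords` (p672826): hM (PRINT, Literature), hE9c = CertE9coords ──
    (hM : FLS2015.s3s5_jRelation_of_isTorsionGaloisRep)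
    (hE9c : ∀ (K : Type) [Field K] [NumberField K], NumberField.IsTotallyReal K →
      Module.finrank ℚ K = 4 → ∀ r : K, r ^ 2 = 5 → ∀ x₁ x₂ x₃ x₄ : K,
        s3s5Quadric x₁ x₂ x₃ x₄ = 0 → s3s5Cubic x₁ x₂ x₃ x₄ = 0 →
          x₄ ≠ 0 → x₃ ^ 2 - x₃ * x₄ - x₄ ^ 2 ≠ 0 →
            (∃ a b : ℚ, x₃ = ((a : K) + (b : K) * r) * x₄) ∧
            (∃ a b : ℚ, x₂ * x₃ = ((a : K) + (b : K) * r) * x₄ ^ 2))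
    -- ── CertB3E7: sheet 4.5 — `certB3E7_of_modelIdentificationInf_of_mordellWeil` (CertB3E7ZDS p675221) with the stub MordellWeilE7 CLOSED BY NAME (`MordellWeilE7`, p682119, module SqrtFiveQuarticCoversCertB3E7MordellWeilE7): hK1inf (NF-K1-E10∞) ONLY ──
    (hK1inf : ∀ (K : Type) [Field K] [NumberField K], Module.finrank ℚ K = 4 → (∃ r : K, r ^ 2 = 5) →
        ∀ E : WeierstrassCurve (NumberField.RingOfIntegers K), E.Δ ≠ 0 →
          (∃ ρ : Literature.NumberTheory.GaloisRepresentations.FramedGaloisRep K (ZMod 3) 2, (∃ e : (E.baseChange K).geomTorsion ((3 : ℕ) : ℤ) ≃+ (Fin 2 → ZMod 3), ∀ (σ : Field.absoluteGaloisGroup K) (P : (E.baseChange K).geomTorsion ((3 : ℕ) : ℤ)), e (σ • P) = ((ρ σ : GL (Fin 2) (ZMod 3)) : Matrix (Fin 2) (Fin 2) (ZMod 3)) *ᵥ (e P)) ∧ ((∀ σ : Field.absoluteGaloisGroup K, (((ρ σ : GL (Fin 2) (ZMod 3)) : Matrix (Fin 2) (Fin 2) (ZMod 3)) 1 0 = 0))))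 →
          (∃ ρ : Literature.NumberTheory.GaloisRepresentations.FramedGaloisRep K (ZMod 7) 2, (∃ e : (E.baseChange K).geomTorsion ((7 : ℕ) : ℤ) ≃+ (Fin 2 → ZMod 7), ∀ (σ : Field.absoluteGaloisGroup K) (P : (E.baseChange K).geomTorsion ((7 : ℕ) : ℤ)), e (σ • P) = ((ρ σ : GL (Fin 2) (ZMod 7)) : Matrix (Fin 2) (Fin 2) (ZMod 7)) *ᵥ (e P)) ∧ ((∀ σ : Field.absoluteGaloisGroup K, (ρ σ : GL (Fin 2) (ZMod 7)) ∈ Subgroup.closure ({(⟨!![0, 5; 3, 0], !![0, 5; 3, 0], by decide, by decide⟩ : GL (Fin 2) (ZMod 7)), (⟨!![5, 0; 3, 2], !![3, 0; 6, 4], by decide, by decide⟩ : GL (Fin 2) (ZMod 7))} : Set (GL (Fin 2) (ZMod 7)))))) →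
          ((E.baseChange K).c₄ ^ 3 = 1728 * (E.baseChange K).Δ ∨
           (∃ x₁ y₁ x₂ y₂ : K, y₁ ^ 2 = 7 * (16 * x₁ ^ 4 + 68 * x₁ ^ 3 + 111 * x₁ ^ 2 + 62 * x₁ + 11) ∧ y₂ ^ 2 = 7 * (16 * x₂ ^ 4 + 68 * x₂ ^ 3 + 111 * x₂ ^ 2 + 62 * x₂ + 11) ∧
            ((x₁ ^ 3 + x₁ ^ 2 - 2 * x₁ - 1) ^ 7) ≠ 0 ∧
            (E.baseChange K).c₄ ^ 3 * ((x₁ ^ 3 + x₁ ^ 2 - 2 * x₁ - 1) ^ 7) = ((3 * x₁ + 1) ^ 3 * (4 * x₁ ^ 2 + 5 * x₁ + 2) ^ 3 * (x₁ ^ 2 + 3 * x₁ + 4) ^ 3 * (x₁ ^ 2 + 10 * x₁ + 4) ^ 3) * (E.baseChange K).Δ ∧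
            ((3 * x₂ ^ 2 + 6 * x₂ + 2) ^ 2 * x₁ ^ 4 + (36 * x₂ ^ 4 + 125 * x₂ ^ 3 + 138 * x₂ ^ 2 + 60 * x₂ + 9) * x₁ ^ 3 + (48 * x₂ ^ 4 + 138 * x₂ ^ 3 + 111 * x₂ ^ 2 + 33 * x₂ + 3) * x₁ ^ 2 + (24 * x₂ ^ 4 + 60 * x₂ ^ 3 + 33 * x₂ ^ 2 + 5 * x₂) * x₁ + (4 * x₂ ^ 4 + 9 * x₂ ^ 3 + 3 * x₂ ^ 2)) = 0) ∨
           (∃ x₁ y₁ z : K, y₁ ^ 2 = 7 * (16 * x₁ ^ 4 + 68 * x₁ ^ 3 + 111 * x₁ ^ 2 + 62 * x₁ + 11) ∧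
            ((x₁ ^ 3 + x₁ ^ 2 - 2 * x₁ - 1) ^ 7) ≠ 0 ∧
            (E.baseChange K).c₄ ^ 3 * ((x₁ ^ 3 + x₁ ^ 2 - 2 * x₁ - 1) ^ 7) = ((3 * x₁ + 1) ^ 3 * (4 * x₁ ^ 2 + 5 * x₁ + 2) ^ 3 * (x₁ ^ 2 + 3 * x₁ + 4) ^ 3 * (x₁ ^ 2 + 10 * x₁ + 4) ^ 3) * (E.baseChange K).Δ ∧
            (3 * x₁ ^ 2 + 6 * x₁ + 2) ^ 2 = 0 ∧ z ^ 2 = 7)))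
    -- ── CertS3H12: sheet 4.7 — `certS3H12_of_modelIdentificationWeak_of_caseTwoEmpty_smooth` (p673359): hNFw (NF-K1 without side conditions), hDat′ = CaseTwoEmptyS3H12-smooth ──
    (hNFw : ∀ (K : Type) [Field K] [NumberField K], NumberField.IsTotallyReal K → Module.finrank ℚ K = 4 → (∃ r : K, r ^ 2 = 5) →
        ∀ E : WeierstrassCurve (NumberField.RingOfIntegers K), E.Δ ≠ 0 →
          (∃ ρ : Literature.NumberTheory.GaloisRepresentations.FramedGaloisRep K (ZMod 3) 2, (∃ e : (E.baseChange K).geomTorsion ((3 : ℕ) : ℤ) ≃+ (Fin 2 → ZMod 3), ∀ (σ : Field.absoluteGaloisGroup K) (P : (E.baseChange K).geomTorsion ((3 : ℕ) : ℤ)), e (σ • P) = ((ρ σ : GL (Fin 2) (ZMod 3)) : Matrix (Fin 2) (Fin 2) (ZMod 3)) *ᵥ (e P)) ∧ ((∀ σ : Field.absoluteGaloisGroup K, (ρ σ : GL (Fin 2) (ZMod 3)) ∈ Subgroup.closure ({(⟨!![1, 0; 0, 2], !![1, 0; 0, 2], by decide, by decide⟩ : GL (Fin 2) (ZMod 3)),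 (⟨!![0, 1; 1, 0], !![0, 1; 1, 0], by decide, by decide⟩ : GL (Fin 2) (ZMod 3))} : Set (GL (Fin 2) (ZMod 3)))))) →
          (∃ ρ : Literature.NumberTheory.GaloisRepresentations.FramedGaloisRep K (ZMod 5) 2, (∃ e : (E.baseChange K).geomTorsion ((5 : ℕ) : ℤ) ≃+ (Fin 2 → ZMod 5), ∀ (σ : Field.absoluteGaloisGroup K) (P : (E.baseChange K).geomTorsion ((5 : ℕ) : ℤ)), e (σ • P) = ((ρ σ : GL (Fin 2) (ZMod 5)) : Matrix (Fin 2) (Fin 2) (ZMod 5)) *ᵥ (e P)) ∧ ((∀ σ : Field.absoluteGaloisGroup K, (ρ σ : GL (Fin 2) (ZMod 5)) ∈ Subgroup.closure ({(⟨!![3, 1; 3, 3], !![3, 4; 2, 3], by decide, by decide⟩ : GL (Fin 2) (ZMod 5)), (⟨!![1, 0; 0, 4], !![1, 0; 0, 4], by decide, by decide⟩ : GL (Fin 2) (ZMod 5))} : Set (GL (Fin 2) (ZMod 5)))))) →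
          ∀ r : K, r ^ 2 = 5 →
            (E.baseChange K).c₄ = 0 ∨
            (E.baseChange K).c₄ ^ 3 = 8000 * (E.baseChange K).Δ ∨
            ∃ u t w : K,
              (E.baseChange K).c₄ ^ 3 * u ^ 3 = 27 * (u + 1) ^ 3 * (u - 3) ^ 3 * (E.baseChange K).Δ ∧
              (E.baseChange K).c₄ ^ 3 * (t ^ 2 + t - 1) ^ 5 =
                125 * (t + 1) * (2 * t + 1) ^ 3 * (2 * t ^ 2 - 3 * t + 3) ^ 3 * (E.baseChange K).Δ ∧
              (5 + 2 * r) * w ^ 2 = 8 * t ^ 2 - 12 * t + 7)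
    (hDat' : ∀ (K : Type) [Field K] [NumberField K], NumberField.IsTotallyReal K → Module.finrank ℚ K = 4 →
        ∀ r : K, r ^ 2 = 5 →
          ∀ t n v w : K,
            n ^ 3 = t ^ 3 + 2 * t ^ 2 - 1 →
            v ^ 2 = (5 * (2 * t + 1) * (2 * t ^ 2 - 3 * t + 3) * n) ^ 2
                + 12 * (5 * (2 * t + 1) * (2 * t ^ 2 - 3 * t + 3) * n) * (t ^ 2 + t - 1) ^ 2
                + 144 * (t ^ 2 + t - 1) ^ 4 →
            (5 + 2 * r) * w ^ 2 = 8 * t ^ 2 - 12 * t + 7 →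
            v ≠ 0 → w ≠ 0 →
            (∃ a b : ℚ, t = (a : K) + (b : K) * r) ∧ (∃ a b : ℚ, n = (a : K) + (b : K) * r))
    -- ── the printed theorems (named Literature facts) ──
    (hFLS : FLS2015_theorem1)
    (hBC : isModularEllipticCurve_baseChange_of_isSolvable_of_isAutomorphicOfWeightZero)
    (h11 : Box2022_theorem1_1) (h15 : Box2022_theorem1_5_modular) (h3 : FLS2015_theorem3)
    (h4 : FLS2015_theorem4) (hKal : Kalyanswamy2018_theorem1_2) : Target :=
  target_of_sheets_of_facts
    (certB3H8_of_modelIdentification_of_coords hK1c hE6c hB) (certH12B7_of_modelIdentificationWeak_of_theoremZ hK1w hZ)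
    (certS3H8_of_facts_coords hM hE9c)
    (certB3E7_of_modelIdentificationInf_of_mordellWeil hK1inf MordellWeilE7)
    (certS3H12_of_modelIdentificationWeak_of_caseTwoEmpty_smooth hNFw hDat')
    hFLS hBC h11 h15 h3 h4 hKal

end Summit.Langlands.Langlands.Theorems.SqrtFiveQuarticCovers
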